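import Literature.AlgebraicGeometry.HodgeTheory.LefschetzPencilHyperplaneSectionsProofs
import Literature.AlgebraicGeometry.Motives.ProjectiveSpaceLinearSpanMaps
import Literature.AlgebraicGeometry.Motives.UniversalHyperplaneSection
import HarnessLib

/-!
# Good pencils with first member in a prescribed open of the dual projective space; the line of a pencil

Topic `Literature/AlgebraicGeometry/Motives` (theorems only). For a smooth projective `X ⊆ ℙᴺ`:

* `isGeneric_ne_zero`, `isGeneric_minor_ne_zero`, `isGeneric_pt_pointOfVec_mem` — generic conditions on
  a linear form: non-zero, not proportional to a given one, `[c] ∈ U` for a non-empty open `U ⊆ ℙᴺ`;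
* `exists_pencil_through_open` — iterated Bertini: a pencil `(a₀, a₁)` of `X` with smooth projective
  total space, geometrically connected net map, `a₀, a₁` not proportional and `[a₀]` in a prescribed
  non-empty open of the dual space;
* `exists_lineMap` — the line `Λ : ℙ¹ ⟶ (ℙᴺ)^*`, `[w₀ : w₁] ↦ [w₁ a₀ − w₀ a₁]`, of a pencil of
  hyperplanes, as a morphism with its action on complex points.

## References

* [Hartshorne1977] R. Hartshorne, Algebraic Geometry, GTM 52 (1977), II Thm. 7.1, Thm. 8.18, Example 7.17.3.
* [VoisinHodgeII2003] C. Voisin, Hodge Theory and Complex Algebraic Geometry II, CUP 2003, §2.1.1 and §3.2.2.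
-/

noncomputable section

open CategoryTheory CategoryTheory.Limits AlgebraicGeometry TopologicalSpace MonoidalCategory
  CartesianMonoidalCategory
open Literature.AlgebraicGeometry.HodgeTheory

universe u

namespace Literature.AlgebraicGeometry.Motives.SectionFamily

/-! ### Generic linear forms: non-zero, independent of a given one, with point in a given open -/
section Generic

open Literature.AlgebraicGeometry.Resolution _root_.MvPolynomial

/-- A generic vector is non-zero. [folklore] -/
theorem isGeneric_ne_zero (N : ℕ) : IsGeneric fun c : Fin (N + 1) → ℂ => c ≠ 0 := by
  refine ⟨X 0, X_ne_zero 0, fun c hc h0 => hc ?_⟩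
  rw [h0, eval_X, Pi.zero_apply]

/-- For `b ≠ 0` (and `N ≥ 1`) a generic `c` is not proportional to `b`: some `2 × 2` minor of `(b, c)`
is non-zero. [folklore] -/
theorem isGeneric_minor_ne_zero {N : ℕ} (hN : 1 ≤ N) {b : Fin (N + 1) → ℂ} (hb : b ≠ 0) :
    IsGeneric fun c : Fin (N + 1) → ℂ => ∃ i j, b i * c j - b j * c i ≠ 0 := by
  obtain ⟨i, hi⟩ := Function.ne_iff.mp hb
  haveI : Nontrivial (Fin (N + 1)) := Fin.nontrivial_iff_two_le.mpr (by omega)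
  obtain ⟨j, hji⟩ := exists_ne i
  refine ⟨C (b i) * X j - C (b j) * X i, ?_, fun c hc => ⟨i, j, ?_⟩⟩
  · intro h
    have h1 := congrArg (coeff (Finsupp.single j 1)) h
    simp only [coeff_sub, coeff_C_mul, coeff_X, coeff_zero, if_true,
      if_neg (fun h' => hji (Finsupp.single_left_injective one_ne_zero h').symm), mul_zero, sub_zero,
      mul_one] at h1
    exact hi h1
  · simpa only [eval_sub, eval_mul, eval_C, eval_X] using hc

/-- **Membership of the point `[c]` in a non-empty open of `ℙᴺ` is a generic condition on `c`**: the
open contains a basic open `D₊(G)` of a non-zero homogeneous `G` (Mathlib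
`ProjectiveSpectrum.isTopologicalBasis_basic_opens` and the decomposition of `r` into homogeneous
components), and `[c] ∈ D₊(G) ↔ G(c) ≠ 0`. [folklore] -/
theorem isGeneric_pt_pointOfVec_mem {N : ℕ} (U : (projectiveSpace N ℂ).left.Opens)
    (hU : (U : Set (projectiveSpace N ℂ).left).Nonempty) :
    IsGeneric fun c : Fin (N + 1) → ℂ => ∀ hc : c ≠ 0, (ProjectiveSpace.pointOfVec ℂ c hc).pt ∈ U := by
  classical
  letI := MvPolynomial.gradedAlgebra (σ := Fin (N + 1)) (R := ℂ)
  obtain ⟨p, hp⟩ := hU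
  -- a basic open `D₊(r) ∋ p` inside `U`
  obtain ⟨_, ⟨r, rfl⟩, hpr, hrU⟩ :=
    (ProjectiveSpectrum.isTopologicalBasis_basic_opens
      (MvPolynomial.homogeneousSubmodule (Fin (N + 1)) ℂ)).exists_subset_of_mem_open hp U.isOpen
  have hpr' : r ∉ ProjectiveSpectrum.asHomogeneousIdeal p :=
    (ProjectiveSpectrum.mem_basicOpen _ r p).mp hpr
  -- a homogeneous component `G = r_i` with `G ∉ 𝔭`, so `p ∈ D₊(G) ⊆ D₊(r) ⊆ U`
  obtain ⟨i, hpi⟩ : ∃ i : ℕ,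
      GradedRing.proj (MvPolynomial.homogeneousSubmodule (Fin (N + 1)) ℂ) i r ∉
        ProjectiveSpectrum.asHomogeneousIdeal p := by
    by_contra H
    push Not at H
    apply hpr'
    rw [← DirectSum.sum_support_decompose (MvPolynomial.homogeneousSubmodule (Fin (N + 1)) ℂ) r]
    exact Ideal.sum_mem _ fun i _ => H i
  set G := GradedRing.proj (MvPolynomial.homogeneousSubmodule (Fin (N + 1)) ℂ) i r with hG
  have hGmem : G ∈ MvPolynomial.homogeneousSubmodule (Fin (N + 1)) ℂ i := by
    rw [hG, GradedRing.proj_apply]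
    exact SetLike.coe_mem _
  have hGU : ∀ q : (projectiveSpace N ℂ).left, G ∉ ProjectiveSpectrum.asHomogeneousIdeal q → q ∈ U := by
    intro q hq
    apply hrU
    rw [ProjectiveSpectrum.mem_coe_basicOpen]
    exact fun hrq => hq ((ProjectiveSpectrum.asHomogeneousIdeal q).isHomogeneous i hrq)
  have hG0 : G ≠ 0 := by
    intro h0
    rw [h0] at hpi
    exact hpi (zero_mem _)
  rcases Nat.eq_zero_or_pos i with rfl | hi
  · -- `G` is a non-zero constant: `D₊(G)` is everything
    have hGc : G = C (coeff 0 G) := by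
      have hh : G.IsHomogeneous 0 := (mem_homogeneousSubmodule 0 G).mp hGmem
      exact totalDegree_eq_zero_iff_eq_C.mp (Nat.le_zero.mp hh.totalDegree_le)
    have hc0 : coeff 0 G ≠ 0 := fun h => hG0 (by rw [hGc, h, C_0])
    have hu : IsUnit G := by rw [hGc]; exact (isUnit_iff_ne_zero.mpr hc0).map C
    refine IsGeneric.of_forall fun c hc => hGU _ fun hmem => ?_
    exact (ProjectiveSpectrum.isPrime _).ne_top (Ideal.eq_top_of_isUnit_mem _ hmem hu)
  · refine ⟨G, hG0, fun c hc hc0 => hGU _ ?_⟩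
    rw [← ProjectiveSpectrum.mem_basicOpen]
    change (ProjectiveSpace.pointOfVec ℂ c hc0).pt ∈
      Proj.basicOpen (MvPolynomial.homogeneousSubmodule (Fin (N + 1)) ℂ) G
    rw [ProjectiveSpace.pt_pointOfVec_mem_basicOpen_iff c hc0 hi hGmem]
    exact hc

end Generic

/-! ### A good pencil of `X` whose first member lies in a prescribed open of the dual space -/
section Pencil

open Literature.AlgebraicGeometry.Resolution
open Literature.AlgebraicGeometry.Morphisms.ProjCech (PP)

/-- **Good pencils through a prescribed open of hyperplanes.** On a smooth projective `X` of
dimension `n + 1 ≥ 2` with a closed immersion `φ : X ⟶ ℙᴺ` (`N ≥ 1`), for every non-empty open `U`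
of the dual projective space there are two linear forms `a = (a₀, a₁)`, `a₀ ≠ 0` with `[a₀] ∈ U`, not
proportional (some `2 × 2` minor is non-zero), whose pencil has smooth projective total space
`X̃ = total φ a` of dimension `n + 1` and net map `π : X̃ ⟶ ℙ¹` with geometrically connected fibres —
iterated Bertini (`LinearSectionNet.isGeneric_regularCut_snoc`, generic conditions combined with the
generic membership `[a₀] ∈ U`, `isGeneric_pt_pointOfVec_mem`), `goodCentre_of_regularCut`,
`isSmoothProjective_total` and `geometricallyConnected_proj_of_goodCentre` (the base locus is
non-empty by the dimension count of `exists_goodCentre` and not everything since `a₀` misses the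
generic point). [cite: Hartshorne1977, II Thm. 8.18 and II Example 7.17.3] [cite: VoisinHodgeII2003, §2.1.1] -/
theorem exists_pencil_through_open {n N : ℕ} {X : SchemeOver ℂ} (hX : IsSmoothProjective (n + 1) X)
    (φ : X ⟶ projectiveSpace N ℂ) [IsClosedImmersion φ.left] (hn : 1 ≤ n) (hN : 1 ≤ N)
    (U : (dualProjectiveSpace N ℂ).left.Opens) (hU : (U : Set (dualProjectiveSpace N ℂ).left).Nonempty) :
    ∃ (a : Fin (1 + 1) → Fin (N + 1) → ℂ) (ha₀ : a 0 ≠ 0),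
      (∃ i j, a 0 i * a 1 j - a 0 j * a 1 i ≠ 0) ∧
      IsSmoothProjective (n + 1) (LinearSectionNet.total φ a) ∧
      GeometricallyConnected (LinearSectionNet.proj φ a).left ∧
      (ProjectiveSpace.pointOfVec ℂ (a 0) ha₀).pt ∈ U := by
  haveI := LinearSectionNet.isIntegral_left hX
  haveI := LinearSectionNet.isNoetherian_left hX
  haveI := LinearSectionNet.jacobsonSpace_left hX
  haveI := LinearSectionNet.isProper_hom hX
  haveI := hX.smoothOfRelativeDimension
  have hreg := LinearSectionNet.isRegular_left hX
  -- the first form: Bertini, missing the generic point, non-zero, with `[a₀] ∈ U`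
  obtain ⟨b₀, ⟨hb₀reg, hb₀η⟩, hb₀U, hb₀ne⟩ :=
    (((LinearSectionNet.isGeneric_regularCut_snoc φ Fin.elim0 (LinearSectionNet.regularCut_zero φ hreg _)).and
      (LinSec.isGeneric_forall_notMem_hyp (LinearSectionNet.ιPP φ) (Set.finite_singleton (genericPoint X.left)))).and
      ((isGeneric_pt_pointOfVec_mem U hU).and (isGeneric_ne_zero N))).nonempty
  -- the second form: Bertini again, not proportional to the first
  obtain ⟨b₁, hb₁reg, i, j, hminor⟩ :=
    ((LinearSectionNet.isGeneric_regularCut_snoc φ _ hb₀reg).and (isGeneric_minor_ne_zero hN hb₀ne)).nonempty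
  have ha : (![b₀, b₁] : Fin (1 + 1) → Fin (N + 1) → ℂ) =
      Fin.snoc (Fin.snoc Fin.elim0 b₀ : Fin (0 + 1) → Fin (N + 1) → ℂ) b₁ := by
    funext l
    fin_cases l <;> rfl
  refine ⟨![b₀, b₁], hb₀ne, ⟨i, j, hminor⟩, ?_⟩
  have hF : LinearSectionNet.GoodCentre φ ![b₀, b₁] := by
    rw [ha]
    exact LinearSectionNet.goodCentre_of_regularCut φ _ hb₁reg
  -- the base locus is non-empty (dimension) and not everything (`a₀` misses the generic point)
  have hne : (LinearSectionNet.baseLocus φ ![b₀, b₁]).Nonempty := by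
    -- adapted from `LinearSectionNet.exists_goodCentre`
    by_contra hne
    rw [Set.not_nonempty_iff_eq_empty] at hne
    have hbpf : LinSec.NoCommonZero (LinearSectionNet.ιPP φ) ![b₀, b₁] :=
      (LinSec.noCommonZero_iff_cutSet_eq_empty (LinearSectionNet.ιPP φ) _).mpr hne
    haveI := LinSec.isFinite_proj (LinearSectionNet.ιPP φ) ![b₀, b₁] X.hom hbpf
    have hle := Scheme.topologicalKrullDim_le_of_locallyQuasiFinite
      (LinSec.proj (LinearSectionNet.ιPP φ) ![b₀, b₁] X.hom hbpf)
    rw [topologicalKrullDim_eq_of_smoothOfRelativeDimension X.hom (n + 1)] at hle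
    have hP : topologicalKrullDim (PP ℂ 1) = 1 := ProjSpace.topologicalKrullDim_eq 1 ℂ
    rw [hP] at hle
    have : n + 1 ≤ 1 := by exact_mod_cast hle
    omega
  have hnu : LinearSectionNet.baseLocus φ ![b₀, b₁] ≠ Set.univ := by
    intro huniv
    have hη : genericPoint X.left ∈ LinearSectionNet.baseLocus φ ![b₀, b₁] := huniv ▸ Set.mem_univ _
    exact hb₀η _ rfl (Set.mem_iInter.mp hη 0)
  have hV := coe_offBase_nonempty φ hnu
  exact ⟨LinearSectionNet.isSmoothProjective_total φ hX hF hV,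
    geometricallyConnected_proj_of_goodCentre φ hX hF hne hnu, hb₀U hb₀ne⟩

end Pencil

/-! ### The line `[w₀ : w₁] ↦ [w₁ a₀ − w₀ a₁]` of a pencil of hyperplanes, as a morphism `ℙ¹ ⟶ (ℙᴺ)^*` -/
section LineMap

open _root_.MvPolynomial

/-- **The line of a pencil of hyperplanes.** For two linear forms `a₀, a₁` on `ℙᴺ` which are not
proportional (some `2 × 2` minor is non-zero) there is a morphism `Λ : ℙ¹ ⟶ (ℙᴺ)^*` over `ℂ` sending
the complex point `[w₀ : w₁]` to the hyperplane `[w₁ a₀ − w₀ a₁]` (the member of the pencil over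
`[w₀ : w₁]`, cf. `HodgeTheory.range_map_fiberι_blowDown`): the linear map
`ProjectiveSpace.linSpanMap` of the forms `τᵢ = a₀ᵢ y₁ − a₁ᵢ y₀`, whose ideal contains `y₀, y₁`.
[cite: VoisinHodgeII2003, §2.1.1] [cite: Hartshorne1977, II Thm. 7.1] -/
theorem exists_lineMap {N : ℕ} (a : Fin (1 + 1) → Fin (N + 1) → ℂ)
    (hminor : ∃ i j, a 0 i * a 1 j - a 0 j * a 1 i ≠ 0) :
    ∃ Λ : projectiveSpace 1 ℂ ⟶ dualProjectiveSpace N ℂ,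
      ∀ (w : Fin (1 + 1) → ℂ) (hw : w ≠ 0), ∃ hc : (fun i => w 1 * a 0 i - w 0 * a 1 i) ≠ 0,
        AlgPoints.map Λ (ProjectiveSpace.pointOfVec ℂ w hw) =
          ProjectiveSpace.pointOfVec ℂ (fun i => w 1 * a 0 i - w 0 * a 1 i) hc := by
  obtain ⟨i, j, hD⟩ := hminor
  -- the forms `τᵢ = a₀ᵢ y₁ − a₁ᵢ y₀`
  let τ : Fin (N + 1) → MvPolynomial (Fin (1 + 1)) ℂ := fun l => C (a 0 l) * X 1 - C (a 1 l) * X 0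
  have hτ : ∀ l, (τ l).IsHomogeneous 1 := fun l =>
    ((isHomogeneous_C _ _).mul (isHomogeneous_X _ _)).sub ((isHomogeneous_C _ _).mul (isHomogeneous_X _ _))
  -- `D y₀ = a₀ⱼ τᵢ − a₀ᵢ τⱼ`, `D y₁ = a₁ⱼ τᵢ − a₁ᵢ τⱼ` for the minor `D ≠ 0`
  have hτi : τ i ∈ Ideal.span (Set.range τ) := Ideal.subset_span ⟨i, rfl⟩
  have hτj : τ j ∈ Ideal.span (Set.range τ) := Ideal.subset_span ⟨j, rfl⟩
  have h0 : (X 0 : MvPolynomial (Fin (1 + 1)) ℂ) =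
      C (a 0 i * a 1 j - a 0 j * a 1 i)⁻¹ * (C (a 0 j) * τ i - C (a 0 i) * τ j) := by
    have h : C (a 0 j) * τ i - C (a 0 i) * τ j = C (a 0 i * a 1 j - a 0 j * a 1 i) * X 0 := by
      simp only [τ, map_sub, map_mul]
      ring
    rw [h, ← mul_assoc, ← C_mul, inv_mul_cancel₀ hD, C_1, one_mul]
  have h1 : (X 1 : MvPolynomial (Fin (1 + 1)) ℂ) =
      C (a 0 i * a 1 j - a 0 j * a 1 i)⁻¹ * (C (a 1 j) * τ i - C (a 1 i) * τ j) := by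
    have h : C (a 1 j) * τ i - C (a 1 i) * τ j = C (a 0 i * a 1 j - a 0 j * a 1 i) * X 1 := by
      simp only [τ, map_sub, map_mul]
      ring
    rw [h, ← mul_assoc, ← C_mul, inv_mul_cancel₀ hD, C_1, one_mul]
  have hgen : ∀ l : Fin (1 + 1), (X l : MvPolynomial (Fin (1 + 1)) ℂ) ∈ Ideal.span (Set.range τ) := by
    intro l
    fin_cases l
    · change (X 0 : MvPolynomial (Fin (1 + 1)) ℂ) ∈ _
      rw [h0]
      exact Ideal.mul_mem_left _ _ (Ideal.sub_mem _ (Ideal.mul_mem_left _ _ hτi) (Ideal.mul_mem_left _ _ hτj))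
    · change (X 1 : MvPolynomial (Fin (1 + 1)) ℂ) ∈ _
      rw [h1]
      exact Ideal.mul_mem_left _ _ (Ideal.sub_mem _ (Ideal.mul_mem_left _ _ hτi) (Ideal.mul_mem_left _ _ hτj))
  refine ⟨ProjectiveSpace.linSpanMap τ hτ hgen, fun w hw => ?_⟩
  have hev : (fun l => aeval w (τ l)) = fun l => w 1 * a 0 l - w 0 * a 1 l := by
    funext l
    simp only [τ, map_sub, map_mul, aeval_C, aeval_X, Algebra.algebraMap_self, RingHom.id_apply]
    ring
  -- `τ(w) ≠ 0`: otherwise `y₀(w) = y₁(w) = 0`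
  have hc : (fun l => w 1 * a 0 l - w 0 * a 1 l) ≠ 0 := by
    rw [← hev]
    intro hz
    apply hw
    have hker : Ideal.span (Set.range τ) ≤ RingHom.ker (aeval w : MvPolynomial (Fin (1 + 1)) ℂ →ₐ[ℂ] ℂ) := by
      rw [Ideal.span_le]
      rintro _ ⟨l, rfl⟩
      exact congrFun hz l
    funext l
    rw [Pi.zero_apply, ← aeval_X (R := ℂ) w l]
    exact hker (hgen l)
  refine ⟨hc, ?_⟩
  rw [AlgPoints.map_apply, ProjectiveSpace.pointOfVec_comp_linSpanMap τ hτ hgen w hw (hev ▸ hc)]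
  congr 1

end LineMap

end Literature.AlgebraicGeometry.Motives.SectionFamily

end
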